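import Mathlib

/-!
# P7CertificateC4xD4 — the finite arithmetic behind the simple eightfold I-6 (P7-InstanceTable.md v2.2)

Setting (paper side): `K = ℚ(ζ₅, √(3+√2))`, a CM field of degree 16 that is NOT abelian over `ℚ`; Galois closure
`L = ℚ(ζ₅, x₁, x₂)` with `x₁ = √(3+√2)`, `x₂ = √(3−√2)`, `x₃ = −x₁`, `x₄ = −x₂` (the roots, indexed `0,1,2,3`),
`G = Gal(L/ℚ) = C₄ × D₄`: `u : ζ₅ ↦ ζ₅²` (trivial on the real field), `D₄` = symmetries of the square `x₁x₂x₃x₄`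
(`r : k ↦ k+1`, `s : k ↦ −k`). Elements are encoded as `(a, m, ε) ∈ ℤ/4 × ℤ/4 × Bool`: `u^a` times the map
`k ↦ m + (if ε then k else −k)`. Complex conjugation is `(2, 0, true)`. `Σ_K = Hom(K, ℂ) ≅ ℤ/4 × ℤ/4` via
`(j, k)` = the embedding with `ζ₅ ↦ ζ₅^{2^j}`, `x₁ ↦ x_{k+1}`; `Gal(L/K)` = stabiliser of `(0,0)` = `{(0,0,±)}`.
CM type `Φ = {(0,0),(0,1),(0,2),(0,3),(1,0),(1,1),(3,2),(3,3)}`; witness `Δ = {(0,0),(0,2),(2,1),(2,3)}`.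

Certified (`decide`, standard axioms): the group law realises composition (`mul_act`), conjugation is central;
`cmType`; `primitive` (right stabiliser of the induced type = `Gal(L/K)`); `Δ_hodge` (balance over all 32 `τ`);
`orbit_card` (4) and `stab` (the explicit subgroup of order 8); `stab_transitive` (`Δ` is one `Stab`-orbit, so the
orbit piece is the `K_O`-Weil space `W_{K_O}(B)`, `K_O = L^{Stab}`, and the balance table says `(B, K_O)` is of Weil
type (2,2) with `dim_{K_O} H¹ = 4`); `no_hodge_pair`; `conj_is_square` (so every index-2 subgroup contains conjugation:
`L` has no imaginary quadratic subfield); the certificate `χ(a,m,ε) = i^a (−1)^m`: a homomorphism, odd, of order 4,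
trivial on `Stab` (`χ_stab`), with `Σ_{x∈Δ} χ̂(x) = 4 ≠ 0` and `χ̂` vanishing on conjugate pairs. By Lemma 2.2 / Cor 2.3 of
p7-minimal-instances.md, `W_{K_O}(B)` meets the algebra generated by divisor classes (and, vacuously, imaginary-quadratic
Weil classes) on all powers of `B` only in `0`; `K` non-abelian ⇒ `B` is not of Fermat type.
-/

namespace HodgeRepro0.P7CertificateC4xD4

open Finset

/-- Group elements `(a, m, ε)`. -/
abbrev Elt := ZMod 4 × ZMod 4 × Bool

/-- Embeddings `(j, k)`. -/
abbrev Pt := ZMod 4 × ZMod 4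

/-- `G` = all 32 triples. -/
def G : Finset Elt := Finset.univ

/-- Action on `Σ_K`. -/
def act (g : Elt) (p : Pt) : Pt := (p.1 + g.1, g.2.1 + (if g.2.2 then p.2 else -p.2))

/-- Group law: `(g * h) p = g (h p)`. -/
def mul (g h : Elt) : Elt := (g.1 + h.1, g.2.1 + (if g.2.2 then h.2.1 else -h.2.1), g.2.2 == h.2.2)

/-- `mul` realises composition of the actions. -/
theorem mul_act : ∀ g h : Elt, ∀ p : Pt, act (mul g h) p = act g (act h p) := by decide

/-- Complex conjugation `u²`. -/
def conj : Elt := (2, 0, true)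

/-- `conj` acts as `(j,k) ↦ (j+2, k)` and is central. -/
theorem conj_central : (∀ p : Pt, act conj p = (p.1 + 2, p.2)) ∧ (∀ g : Elt, mul conj g = mul g conj) := by decide

/-- `Gal(L/K)` = stabiliser of the base point `(0,0)`. -/
def H : Finset Elt := G.filter (fun h => act h (0, 0) = (0, 0))

/-- `|Gal(L/K)| = 2`. -/
theorem H_card : H.card = 2 := by decide

/-- The CM type. -/
def Φ : Finset Pt := {(0, 0), (0, 1), (0, 2), (0, 3), (1, 0), (1, 1), (3, 2), (3, 3)}

/-- The witness. -/
def Δ : Finset Pt := {(0, 0), (0, 2), (2, 1), (2, 3)}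

/-- `Φ` is a CM type. -/
theorem cmType : ∀ p : Pt, (p ∈ Φ ↔ act conj p ∉ Φ) := by decide

/-- The induced type `Φ̃ ⊂ G`. -/
def Φt : Finset Elt := G.filter (fun g => act g (0, 0) ∈ Φ)

/-- Primitivity: the right stabiliser of `Φ̃` is exactly `Gal(L/K)`. -/
theorem primitive : G.filter (fun h => Φt.image (fun g => mul g h) = Φt) = H := by decide

/-- Balance condition. -/
def IsHodgeSet (S : Finset Pt) : Prop := ∀ τ ∈ G, 2 * (S ∩ Φ.image (act τ)).card = S.card

/-- Decidability of the balance condition. -/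
instance (S : Finset Pt) : Decidable (IsHodgeSet S) := by unfold IsHodgeSet; infer_instance

/-- `e_Δ` is a Hodge class of type (2,2): the 32-row balance table. -/
theorem Δ_hodge : IsHodgeSet Δ := by decide

/-- The orbit of `Δ` has 4 elements. -/
theorem orbit_card : (G.image (fun τ => Δ.image (act τ))).card = 4 := by decide

/-- The stabiliser of `Δ`. -/
def Stab : Finset Elt := G.filter (fun τ => Δ.image (act τ) = Δ)

/-- `Stab` explicitly: order 8, containing `Gal(L/K)`. -/
theorem stab : Stab = {(0, 0, true), (0, 0, false), (0, 2, true), (0, 2, false),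
    (2, 1, true), (2, 1, false), (2, 3, true), (2, 3, false)} := by decide

/-- `Stab ⊇ Gal(L/K)`, so `K_O = L^{Stab} ⊂ K`. -/
theorem H_subset_stab : H ⊆ Stab := by decide

/-- `Δ` is a single `Stab`-orbit: the orbit piece is `Λ⁴_{K_O} H¹(B) = W_{K_O}(B)`. -/
theorem stab_transitive : ∀ p ∈ Δ, ∀ q ∈ Δ, ∃ h ∈ Stab, act h p = q := by decide

/-- Weil type (2,2) over `K_O`: every translate `τΔ` (= fibre of `Σ_K → Hom(K_O, ℂ)`) meets `Φ` in exactly 2 points. -/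
theorem weil_type : ∀ τ ∈ G, ((Δ.image (act τ)) ∩ Φ).card = 2 := by decide

/-- No 2-element subset of `Δ` is balanced. -/
theorem no_hodge_pair : ∀ a ∈ Δ, ∀ b ∈ Δ, a ≠ b → ¬ IsHodgeSet {a, b} := by decide

/-- Conjugation is a square, hence lies in every index-2 subgroup: `L` has no imaginary quadratic subfield. -/
theorem conj_is_square : mul (1, 0, true) (1, 0, true) = conj := by decide

/-- The certificate character `χ(a, m, ε) = i^a (−1)^m`. -/
def χ (g : Elt) : GaussianInt :=
  (if g.1 = 0 then 1 else if g.1 = 1 then ⟨0, 1⟩ else if g.1 = 2 then -1 else ⟨0, -1⟩) *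
  (if g.2.1.val % 2 = 0 then 1 else -1)

/-- `χ` is a homomorphism, odd, of order 4, and trivial on `Stab`. -/
theorem χ_hom : (∀ g h : Elt, χ (mul g h) = χ g * χ h) ∧ χ conj = -1 ∧
    χ (1, 0, true) * χ (1, 0, true) = -1 ∧ (∀ h ∈ Stab, χ h = 1) := by decide

/-- `χ` descends to `Σ_K`: `χ̂(j, k) = i^j (−1)^k` (`χ` is trivial on `Gal(L/K)`). -/
def χhat (p : Pt) : GaussianInt := χ (p.1, p.2, true)

/-- `χ̂(g·(0,0)) = χ(g)`: `χ̂` is the descent of `χ`. -/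
theorem χhat_descent : ∀ g : Elt, χhat (act g (0, 0)) = χ g := by decide

/-- The certificate value `Σ_{x ∈ Δ} χ̂(x) = 4 ≠ 0`. -/
theorem χ_sum_Δ : Δ.sum χhat = 4 ∧ Δ.sum χhat ≠ 0 := by decide

/-- `χ̂` vanishes on every conjugate pair `{p, ιp}` (characters of divisor classes). -/
theorem χ_pair : ∀ p : Pt, χhat p + χhat (act conj p) = 0 := by decide

/-- Packaged certificate for I-6. -/
theorem certificate :
    IsHodgeSet Δ ∧ (G.image (fun τ => Δ.image (act τ))).card = 4 ∧
    (∀ p ∈ Δ, ∀ q ∈ Δ, ∃ h ∈ Stab, act h p = q) ∧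
    mul (1, 0, true) (1, 0, true) = conj ∧
    Δ.sum χhat ≠ 0 ∧ (∀ p : Pt, χhat p + χhat (act conj p) = 0) :=
  ⟨Δ_hodge, orbit_card, stab_transitive, conj_is_square, χ_sum_Δ.2, χ_pair⟩

end HodgeRepro0.P7CertificateC4xD4
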